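import Literature.MeasureTheory.Integral.IteratedIntegralDiracLimit
import HarnessLib

/-!
# `∫∫ Dᵢ(y₁, y₂) dνᵢ(y₂) dμᵢ(y₁) → ∫∫ D dν dμ` when `μᵢ → μ`, `νᵢ → ν` weakly and `Dᵢ → D`
# uniformly (continuity in time of `Var_t(μ_{1,t}, μ_{2,t})`, Bamler 2020a, §3)

R. Bamler, *Entropy and heat kernel bounds on a Ricci flow background*, arXiv:2008.07093 (2020a),
§3: the variance `Var_t(μ_{1,t}, μ_{2,t}) = ∫∫ d_t² dμ_{1,t} dμ_{2,t}` of two weakly continuous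
families of probability measures for a continuously varying distance is continuous in `t`; at a
pole it tends to `d²(x₁, x₂)` (Cor. 9). `IteratedIntegralDiracLimit.lean` has the Dirac case; this
file proves the general weak limit on a compact space `X`: if probability measures `μᵢ → μ`,
`νᵢ → ν` weakly (against continuous functions) along a filter, `D : X × X → ℝ` is continuous and
the continuous `Dᵢ → D` uniformly, then `∫∫ Dᵢ(y₁, y₂) dνᵢ(y₂) dμᵢ(y₁) → ∫∫ D dν dμ`:

* `tendstoUniformly_integral_of_tendsto` — `y₁ ↦ ∫ D(y₁, ·) dνᵢ` converges UNIFORMLY to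
  `y₁ ↦ ∫ D(y₁, ·) dν` (equicontinuity + pointwise convergence on a finite cover);
* `tendsto_integral_integral_of_tendsto` — the statement.

Everything is proved; no definitions, no named facts.

## References

* R. H. Bamler, *Entropy and heat kernel bounds on a Ricci flow background*, arXiv:2008.07093
  (2020), §3.2, proof of Cor. 9.
* P. Billingsley, *Convergence of probability measures*, 2nd ed. (1999), §2 (weak convergence).
-/

noncomputable section

open Set Filter Topology
open _root_.MeasureTheory

namespace Literature.MeasureTheory.Integral

variable {X : Type*} [TopologicalSpace X] [CompactSpace X]
  [MeasurableSpace X] [OpensMeasurableSpace X]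

/-- **Uniform convergence of the inner integrals**: if `νᵢ → ν` weakly (against continuous
functions) and `D : X × X → ℝ` is continuous on the compact `X × X`, then
`y₁ ↦ ∫ D(y₁, y₂) dνᵢ(y₂)` converges to `y₁ ↦ ∫ D(y₁, y₂) dν(y₂)` uniformly (equicontinuity +
pointwise convergence at finitely many points). [folklore] -/
theorem tendstoUniformly_integral_of_tendsto {ι : Type*} {l : Filter ι}
    {ν : ι → Measure X} [∀ i, IsProbabilityMeasure (ν i)] {ν₀ : Measure X} [IsProbabilityMeasure ν₀]
    (hν : ∀ φ : X → ℝ, Continuous φ → Tendsto (fun i ↦ ∫ y, φ y ∂ν i) l (𝓝 (∫ y, φ y ∂ν₀)))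
    {D : X × X → ℝ} (hD : Continuous D) :
    TendstoUniformly (fun i y₁ ↦ ∫ y₂, D (y₁, y₂) ∂ν i) (fun y₁ ↦ ∫ y₂, D (y₁, y₂) ∂ν₀) l := by
  rw [Metric.tendstoUniformly_iff]
  intro ε hε
  have hε3 : 0 < ε / 3 := by positivity
  have hint : ∀ (y₁ : X) (ρ : Measure X) [IsFiniteMeasure ρ], Integrable (fun y₂ ↦ D (y₁, y₂)) ρ :=
    fun y₁ ρ _ ↦ (hD.comp (continuous_const.prodMk continuous_id)).integrable_of_hasCompactSupport
      (HasCompactSupport.of_compactSpace _)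
  -- equicontinuity neighbourhoods
  have hD' : Continuous fun q : X × X ↦ D (q.2, q.1) := hD.comp (continuous_snd.prodMk continuous_fst)
  have hU : ∀ y₁ : X, ∃ U ∈ 𝓝 y₁, ∀ z ∈ U, ∀ y₂, |D (z, y₂) - D (y₁, y₂)| < ε / 3 := by
    intro y₁
    have hev := eventually_forall_abs_sub_lt (Φ := fun q : X × X ↦ D (q.2, q.1)) hD' y₁ hε3
    exact ⟨{z | ∀ y₂, |D (z, y₂) - D (y₁, y₂)| < ε / 3}, hev, fun z hz ↦ hz⟩
  choose U hUn hUε using hU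
  obtain ⟨s, -, hcover⟩ := isCompact_univ.elim_nhds_subcover U fun y₁ _ ↦ hUn y₁
  -- the slices through the centres converge
  set L : X → ℝ := fun y₁ ↦ ∫ y₂, D (y₁, y₂) ∂ν₀ with hL
  have hpt : ∀ᶠ i in l, ∀ y₁ ∈ s, |(∫ y₂, D (y₁, y₂) ∂ν i) - L y₁| < ε / 3 := by
    have : ∀ y₁ ∈ s, ∀ᶠ i in l, |(∫ y₂, D (y₁, y₂) ∂ν i) - L y₁| < ε / 3 := by
      intro y₁ _
      have h1 := hν (fun y₂ ↦ D (y₁, y₂)) (hD.comp (continuous_const.prodMk continuous_id))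
      rw [Metric.tendsto_nhds] at h1
      simpa only [Real.dist_eq] using h1 (ε / 3) hε3
    exact (s.eventually_all).2 this
  filter_upwards [hpt] with i hi y₁
  obtain ⟨c, hcs, hyc⟩ : ∃ c ∈ s, y₁ ∈ U c := by
    simpa only [mem_iUnion, exists_prop] using hcover (mem_univ y₁)
  -- the three terms
  have hdiff : ∀ (ρ : Measure X) [IsProbabilityMeasure ρ],
      |(∫ y₂, D (y₁, y₂) ∂ρ) - ∫ y₂, D (c, y₂) ∂ρ| ≤ ε / 3 := by
    intro ρ _
    rw [← integral_sub (hint y₁ ρ) (hint c ρ)]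
    exact abs_integral_le_of_forall_abs_le _ fun y₂ ↦ (hUε c y₁ hyc y₂).le
  have h1 := hdiff (ν i)
  have h2 : |L y₁ - L c| ≤ ε / 3 := hdiff ν₀
  have h3 := hi c hcs
  rw [Real.dist_eq, abs_sub_comm]
  calc |(∫ y₂, D (y₁, y₂) ∂ν i) - L y₁|
      = |((∫ y₂, D (y₁, y₂) ∂ν i) - ∫ y₂, D (c, y₂) ∂ν i) +
          ((∫ y₂, D (c, y₂) ∂ν i) - L c) + (L c - L y₁)| := by congr 1; ring
    _ ≤ |(∫ y₂, D (y₁, y₂) ∂ν i) - ∫ y₂, D (c, y₂) ∂ν i| +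
          |(∫ y₂, D (c, y₂) ∂ν i) - L c| + |L c - L y₁| := abs_add_three _ _ _
    _ < ε := by rw [abs_sub_comm (L c)]; linarith

/-- **`∫∫ Dᵢ dνᵢ dμᵢ → ∫∫ D dν dμ`**: on a compact space, if the probability measures `μᵢ → μ`,
`νᵢ → ν` weakly (against continuous functions), `D` is continuous, the `Dᵢ` are continuous and
`Dᵢ → D` uniformly on `X × X`, then `∫ (∫ Dᵢ(y₁, y₂) dνᵢ(y₂)) dμᵢ(y₁) → ∫ (∫ D(y₁, y₂) dν(y₂)) dμ(y₁)`
(continuity in time of `Var_t(μ_{1,t}, μ_{2,t})` along weakly continuous families).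
[folklore] -/
theorem tendsto_integral_integral_of_tendsto {ι : Type*} {l : Filter ι}
    {μ ν : ι → Measure X} [∀ i, IsProbabilityMeasure (μ i)] [∀ i, IsProbabilityMeasure (ν i)]
    {μ₀ ν₀ : Measure X} [IsProbabilityMeasure μ₀] [IsProbabilityMeasure ν₀]
    (hμ : ∀ φ : X → ℝ, Continuous φ → Tendsto (fun i ↦ ∫ y, φ y ∂μ i) l (𝓝 (∫ y, φ y ∂μ₀)))
    (hν : ∀ φ : X → ℝ, Continuous φ → Tendsto (fun i ↦ ∫ y, φ y ∂ν i) l (𝓝 (∫ y, φ y ∂ν₀)))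
    {D : X × X → ℝ} (hD : Continuous D) {Di : ι → X × X → ℝ} (hDi : ∀ i, Continuous (Di i))
    (hunif : TendstoUniformly Di D l) :
    Tendsto (fun i ↦ ∫ y₁, ∫ y₂, Di i (y₁, y₂) ∂ν i ∂μ i) l
      (𝓝 (∫ y₁, ∫ y₂, D (y₁, y₂) ∂ν₀ ∂μ₀)) := by
  set L : X → ℝ := fun y₁ ↦ ∫ y₂, D (y₁, y₂) ∂ν₀ with hL
  have hLc : Continuous L := continuous_integral_of_continuous_prod ν₀ hD
  rw [Metric.tendsto_nhds]
  intro ε hε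
  have hε3 : 0 < ε / 3 := by positivity
  have h1 : ∀ᶠ i in l, ∀ q, |Di i q - D q| < ε / 3 := by
    have := (Metric.tendstoUniformly_iff.1 hunif) (ε / 3) hε3
    filter_upwards [this] with i hi q
    rw [abs_sub_comm, ← Real.dist_eq]; exact hi q
  have h2 : ∀ᶠ i in l, ∀ y₁, |(∫ y₂, D (y₁, y₂) ∂ν i) - L y₁| < ε / 3 := by
    have := (Metric.tendstoUniformly_iff.1 (tendstoUniformly_integral_of_tendsto hν hD)) (ε / 3) hε3
    filter_upwards [this] with i hi y₁
    rw [abs_sub_comm, ← Real.dist_eq]; exact hi y₁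
  have h3 : ∀ᶠ i in l, |(∫ y₁, L y₁ ∂μ i) - ∫ y₁, L y₁ ∂μ₀| < ε / 3 := by
    have := hμ L hLc
    rw [Metric.tendsto_nhds] at this
    simpa only [Real.dist_eq] using this (ε / 3) hε3
  filter_upwards [h1, h2, h3] with i hi1 hi2 hi3
  set F : X → ℝ := fun y₁ ↦ ∫ y₂, Di i (y₁, y₂) ∂ν i with hF
  set G : X → ℝ := fun y₁ ↦ ∫ y₂, D (y₁, y₂) ∂ν i with hG
  have hFc : Continuous F := continuous_integral_of_continuous_prod (ν i) (hDi i)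
  have hGc : Continuous G := continuous_integral_of_continuous_prod (ν i) hD
  have hint : ∀ {f : X → ℝ}, Continuous f → ∀ (ρ : Measure X) [IsFiniteMeasure ρ], Integrable f ρ :=
    fun hf ρ _ ↦ hf.integrable_of_hasCompactSupport (HasCompactSupport.of_compactSpace _)
  have hFG : ∀ y₁, |F y₁ - G y₁| ≤ ε / 3 := by
    intro y₁
    have hI1 : Integrable (fun y₂ ↦ Di i (y₁, y₂)) (ν i) :=
      hint ((hDi i).comp (continuous_const.prodMk continuous_id)) _
    have hI2 : Integrable (fun y₂ ↦ D (y₁, y₂)) (ν i) :=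
      hint (hD.comp (continuous_const.prodMk continuous_id)) _
    simp only [hF, hG]
    rw [← integral_sub hI1 hI2]
    exact abs_integral_le_of_forall_abs_le _ fun y₂ ↦ (hi1 (y₁, y₂)).le
  have hA : |(∫ y₁, F y₁ ∂μ i) - ∫ y₁, G y₁ ∂μ i| ≤ ε / 3 := by
    rw [← integral_sub (hint hFc _) (hint hGc _)]
    exact abs_integral_le_of_forall_abs_le _ hFG
  have hB : |(∫ y₁, G y₁ ∂μ i) - ∫ y₁, L y₁ ∂μ i| ≤ ε / 3 := by
    rw [← integral_sub (hint hGc _) (hint hLc _)]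
    exact abs_integral_le_of_forall_abs_le _ fun y₁ ↦ (hi2 y₁).le
  rw [Real.dist_eq]
  show |(∫ y₁, F y₁ ∂μ i) - ∫ y₁, L y₁ ∂μ₀| < ε
  calc |(∫ y₁, F y₁ ∂μ i) - ∫ y₁, L y₁ ∂μ₀|
      = |((∫ y₁, F y₁ ∂μ i) - ∫ y₁, G y₁ ∂μ i) + ((∫ y₁, G y₁ ∂μ i) - ∫ y₁, L y₁ ∂μ i) +
          ((∫ y₁, L y₁ ∂μ i) - ∫ y₁, L y₁ ∂μ₀)| := by congr 1; ring
    _ ≤ |(∫ y₁, F y₁ ∂μ i) - ∫ y₁, G y₁ ∂μ i| + |(∫ y₁, G y₁ ∂μ i) - ∫ y₁, L y₁ ∂μ i| +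
          |(∫ y₁, L y₁ ∂μ i) - ∫ y₁, L y₁ ∂μ₀| := abs_add_three _ _ _
    _ < ε := by linarith

end Literature.MeasureTheory.Integral

end
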